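import Mathlib
import HarnessLib
import Summits.HubbardSuperconductivity.HubbardSuperconductivity.Theorems.KLProgrammeCutCurrencyLegMassNumeric

/-!
# Route `KLProgramme` — ENGINE (stmt-HubbardSuperconductivity-20437 `KLRegimeEngineV17F2`), located #25 «(b)-PLAIN-UV-TAIL», cure (α),
# E1 item (i), SHARPER NUMBER: the total-variation middle region ⇒ `A(ĝ∘ω) ≤ 8` and `ε³Σ‖W₄(S_ĝV)‖ ≤ (|U|/24)·8⁴` uniformly in `128 ≤ β ≤ M`
# (cell gate-hubbard-kl, seat hubbard-kl-k3c2-p2 g35)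

`…LegMassNumeric` proved `A ≤ 15` from the two-region split (`|ĉ| ≤ S` near, `|ĉ| ≤ C₂N²/16d²` far).  Inserting the MIDDLE region from ONE summation by parts
with the total variation of the cut samples — `Σ_v|ĝ(ω_{v−1}) − ĝ(ω_v)| ≤ 2` (the samples rise to the plateau and fall back: `klct_firstDiffSum_uvCut_le`) ⇒
`|ĉ(j)|·(4d/N) ≤ 2` — and the harmonic bound `Σ_{J₁<d≤J₂} d⁻¹ ≤ 1 + log(J₂/J₁)` gives the three-region lemma `klct_sum_le_of_three_regions` and
**`klct_legMass_uvCut_le_eight`**: `A ≤ 1 + 3S/N + 1 + log(J₂/J₁) + 1 < 8` at `J₁ = ⌈N/2S⌉`, `J₂ = ⌈C₂N/8⌉` (`J₂/J₁ ≤ C₂S/4 + S/β < 128`, `C₂S ≤ 362` for `β ≥ 128`),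
whence **`klbv_plainCurrency_uvCut_hubbardInteraction_le_sharp`**: `ε_x³Σ_{x′:x′_q=y}‖W₄(S_ĝ V)(x′)‖ ≤ (|U|/24)·8⁴ = (|U|/24)·4096` for all `128 ≤ β ≤ M` ([float] truth `2.72`).
No definition; nothing asserts any row, (b), (C), K3, U₀, the window or superconductivity.
References: BGM 2006 §2.2–2.3 [cite: BenfattoGiulianiMastropietro2006]; Zygmund, Trigonometric Series I §II.2 [folklore].
-/

noncomputable section

namespace Summit.HubbardSuperconductivity.HubbardSuperconductivity.Theorems.KLRegimeSplit

set_option linter.dupNamespace false -- summit = problem name (single-conjunct summit), D-0017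

open Finset Literature.MathematicalPhysics.QuantumLattice Literature.Probability.LatticeModels GrassmannAlgebra

variable {L M : ℕ} [NeZero M]

/-! ## §1 The total variation of the cut samples: `Σ_v |ĝ(ω_{v−1}) − ĝ(ω_v)| ≤ 2` -/

/-- The cut profile is antitone in `|ω|`: `|a| ≤ |b| ⇒ ĝ(b) ≤ ĝ(a)`. -/
theorem klct_uvCutoff_antitone {a b : ℝ} (hab : |a| ≤ |b|) : gnScaleCutoff 4 klE0 1 |b| ≤ gnScaleCutoff 4 klE0 1 |a| := by
  rw [klct_uvCutoff_eq_profile, klct_uvCutoff_eq_profile]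
  exact Real.smoothTransition.monotone (by linarith)

/-- **Total variation of the cut samples** (`2 ≤ β ≤ M`): `Σ_{v ∈ ℤ_{2M}} |ĝ(ω_{v−1}) − ĝ(ω_v)| ≤ 2` — the samples increase for `v ≤ M − 1` (`ω_v ↑ 0⁻`), are equal at
`v = M` (`ω_{M−1} = −ω_M`), decrease for `v ≥ M + 1`, and the wrap-around term vanishes; two telescoping sums. -/
theorem klct_firstDiffSum_uvCut_le {β : ℝ} (hβ : 2 ≤ β) (hM : β ≤ M) :
    ∑ v : MatsubaraIdx M, ‖(((gnScaleCutoff 4 klE0 1 |matsubaraFreq β M (v - 1)| : ℝ) : ℂ)) - (((gnScaleCutoff 4 klE0 1 |matsubaraFreq β M v| : ℝ) : ℂ))‖ ≤ 2 := by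
  classical
  have hβ0 : 0 < β := by linarith
  have hMne := NeZero.ne M
  have hM2 : 2 ≤ M := by have : (2 : ℝ) ≤ M := hβ.trans hM; exact_mod_cast this
  -- the samples as a function of the natural index
  set F : ℕ → ℝ := fun k => gnScaleCutoff 4 klE0 1 |Real.pi * (2 * ((k : ℝ) - M) + 1) / β| with hF
  have hFval : ∀ v : MatsubaraIdx M, gnScaleCutoff 4 klE0 1 |matsubaraFreq β M v| = F (v : ℕ) := by
    intro v; simp only [hF, matsubaraFreq, matsubaraInt]; push_cast; ring_nf
  have hF01 : ∀ k, F k ∈ Set.Icc (0 : ℝ) 1 := fun k => klct_uvCutoff_mem_Icc _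
  -- monotone pieces
  have hup : ∀ k : ℕ, 1 ≤ k → k + 1 ≤ M → F (k - 1) ≤ F k := by
    intro k hk hkM
    apply klct_uvCutoff_antitone
    have hkR : ((k : ℕ) : ℝ) + 1 ≤ M := by exact_mod_cast hkM
    have hk1 : (((k - 1 : ℕ)) : ℝ) = (k : ℝ) - 1 := by rw [Nat.cast_sub hk]; simp
    rw [hk1, abs_of_neg (by rw [div_neg_iff]; right; constructor <;> nlinarith [Real.pi_pos]),
      abs_of_neg (by rw [div_neg_iff]; right; constructor <;> nlinarith [Real.pi_pos])]
    rw [neg_le_neg_iff, div_le_div_iff_of_pos_right hβ0]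
    nlinarith [Real.pi_pos]
  have hdown : ∀ k : ℕ, M + 1 ≤ k → F k ≤ F (k - 1) := by
    intro k hk
    apply klct_uvCutoff_antitone
    have hkR : (M : ℝ) + 1 ≤ k := by exact_mod_cast hk
    have hk1 : (((k - 1 : ℕ)) : ℝ) = (k : ℝ) - 1 := by rw [Nat.cast_sub (by omega)]; simp
    rw [hk1, abs_of_pos (by apply div_pos _ hβ0; nlinarith [Real.pi_pos]), abs_of_pos (by apply div_pos _ hβ0; nlinarith [Real.pi_pos])]
    rw [div_le_div_iff_of_pos_right hβ0]
    nlinarith [Real.pi_pos]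
  have hmid : F (M - 1) = F M := by
    simp only [hF]
    congr 1
    have : (((M - 1 : ℕ)) : ℝ) = (M : ℝ) - 1 := by rw [Nat.cast_sub (by omega)]; simp
    rw [this, show 2 * ((M : ℝ) - 1 - M) + 1 = -1 by ring, show 2 * ((M : ℝ) - M) + 1 = 1 by ring, mul_neg_one, mul_one, neg_div, abs_neg]
  -- edge values vanish
  have hF0 : F 0 = 0 := by
    have h := klct_uvCutoff_edge_eq_zero hβ hM (⟨0, by omega⟩ : MatsubaraIdx M) (Or.inl (by simp))
    rw [hFval] at h; exact h
  have hFN : F (2 * M - 1) = 0 := by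
    have h := klct_uvCutoff_edge_eq_zero hβ hM (⟨2 * M - 1, by omega⟩ : MatsubaraIdx M) (Or.inr (by simp; omega))
    rw [hFval] at h; exact h
  -- the summand as a function of the natural index
  set H : ℕ → ℝ := fun k => if k = 0 then |F (2 * M - 1) - F 0| else |F (k - 1) - F k| with hH
  have hsummand : ∀ v : MatsubaraIdx M,
      ‖(((gnScaleCutoff 4 klE0 1 |matsubaraFreq β M (v - 1)| : ℝ) : ℂ)) - (((gnScaleCutoff 4 klE0 1 |matsubaraFreq β M v| : ℝ) : ℂ))‖ = H (v : ℕ) := by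
    intro v
    rw [show (((gnScaleCutoff 4 klE0 1 |matsubaraFreq β M (v - 1)| : ℝ) : ℂ)) - (((gnScaleCutoff 4 klE0 1 |matsubaraFreq β M v| : ℝ) : ℂ)) =
        (((gnScaleCutoff 4 klE0 1 |matsubaraFreq β M (v - 1)| - gnScaleCutoff 4 klE0 1 |matsubaraFreq β M v| : ℝ)) : ℂ) by push_cast; ring,
      Complex.norm_real, Real.norm_eq_abs, hFval, hFval]
    by_cases hv0 : (v : ℕ) = 0
    · simp only [hH, hv0, if_true, klct_val_sub_one_of_zero hv0]
    · have hv1 : 1 ≤ (v : ℕ) := Nat.one_le_iff_ne_zero.mpr hv0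
      simp only [hH, hv0, if_false, klct_val_sub_one hv1]
  simp_rw [hsummand]
  rw [Fin.sum_univ_eq_sum_range (fun k => H k) (2 * M)]
  -- split `range (2M) = {0} ∪ [1, M) ∪ {M} ∪ [M+1, 2M)`
  have hsplit : ∑ k ∈ range (2 * M), H k = H 0 + ∑ k ∈ Ico 1 M, H k + H M + ∑ k ∈ Ico (M + 1) (2 * M), H k := by
    rw [Finset.range_eq_Ico, ← Finset.sum_Ico_consecutive H (show 0 ≤ 1 by omega) (show 1 ≤ 2 * M by omega),
      ← Finset.sum_Ico_consecutive H (show 1 ≤ M by omega) (show M ≤ 2 * M by omega),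
      ← Finset.sum_Ico_consecutive H (show M ≤ M + 1 by omega) (show M + 1 ≤ 2 * M by omega)]
    rw [Nat.Ico_zero_eq_range, Finset.sum_range_one, Nat.Ico_succ_singleton, Finset.sum_singleton]
    ring
  rw [hsplit]
  have e0 : H 0 = 0 := by simp [hH, hF0, hFN]
  have eM : H M = 0 := by simp [hH, hMne, hmid]
  -- rising part telescopes to `F(M−1) − F 0`
  have e1 : ∑ k ∈ Ico 1 M, H k = F (M - 1) - F 0 := by
    have hk : ∀ k ∈ Ico 1 M, H k = F k - F (k - 1) := by
      intro k hk
      rw [Finset.mem_Ico] at hk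
      simp only [hH, show k ≠ 0 by omega, if_false]
      rw [abs_sub_comm, abs_of_nonneg (sub_nonneg.mpr (hup k hk.1 (by omega)))]
    rw [Finset.sum_congr rfl hk, Finset.sum_Ico_eq_sum_range]
    have hre : ∑ k ∈ range (M - 1), (F (1 + k) - F (1 + k - 1)) = ∑ i ∈ range (M - 1), (F (i + 1) - F i) :=
      Finset.sum_congr rfl (fun i _ => by rw [show 1 + i = i + 1 by ring, Nat.add_sub_cancel])
    rw [hre, Finset.sum_range_sub]
  -- falling part telescopes to `F M − F(2M−1)`
  have e2 : ∑ k ∈ Ico (M + 1) (2 * M), H k = F M - F (2 * M - 1) := by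
    have hk : ∀ k ∈ Ico (M + 1) (2 * M), H k = F (k - 1) - F k := by
      intro k hk
      rw [Finset.mem_Ico] at hk
      simp only [hH, show k ≠ 0 by omega, if_false]
      rw [abs_of_nonneg (sub_nonneg.mpr (hdown k hk.1))]
    rw [Finset.sum_congr rfl hk, Finset.sum_Ico_eq_sum_range]
    have hre : ∑ k ∈ range (2 * M - (M + 1)), (F (M + 1 + k - 1) - F (M + 1 + k)) = ∑ i ∈ range (2 * M - (M + 1)), (F (M + i) - F (M + (i + 1))) :=
      Finset.sum_congr rfl (fun i _ => by rw [show M + 1 + i - 1 = M + i by omega, show M + 1 + i = M + (i + 1) by ring])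
    rw [hre, Finset.sum_range_sub', add_zero, show M + (2 * M - (M + 1)) = 2 * M - 1 by omega]
  rw [e0, eM, e1, e2, hF0, hFN]
  have h1 := (hF01 (M - 1)).2
  have h2 := (hF01 M).2
  linarith

/-! ## §2 Linear pointwise decay: `|ĉ(j)|·(4d/N) ≤ 2` -/

/-- **LINEAR POINTWISE DECAY** (`2 ≤ β ≤ M`): `|ĉ(j)|·(4·min(j,2M−j)/2M) ≤ 2` (one summation by parts + total variation `≤ 2`). -/
theorem klct_legTransform_uvCut_lin_decay {β : ℝ} (hβ : 2 ≤ β) (hM : β ≤ M) (j : ImagTimeIdx M) :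
    ‖∑ n : MatsubaraIdx M, (((gnScaleCutoff 4 klE0 1 |matsubaraFreq β M n| : ℝ) : ℂ)) *
        Complex.exp (-((2 * Real.pi * ((n : ℕ) : ℝ) * ((j : ℕ) : ℝ) / (2 * M) : ℝ) : ℂ) * Complex.I)‖ *
      (4 * min ((j : ℕ) : ℝ) (((2 * M : ℕ) : ℝ) - (j : ℕ)) / ((2 * M : ℕ) : ℝ)) ≤ 2 := by
  have hMne := NeZero.ne M
  have hN : 0 < 2 * M := by omega
  have hcast : (2 * (M : ℝ)) = ((2 * M : ℕ) : ℝ) := by push_cast; ring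
  set z : ℂ := Complex.exp (-((2 * Real.pi * ((j : ℕ) : ℝ) / ((2 * M : ℕ) : ℝ) : ℝ) : ℂ) * Complex.I) with hz
  have hzN : z ^ (2 * M) = 1 := klct_rootOfUnity_pow (N := 2 * M) (j : ℕ)
  have hphase : ∀ n : MatsubaraIdx M,
      Complex.exp (-((2 * Real.pi * ((n : ℕ) : ℝ) * ((j : ℕ) : ℝ) / (2 * M) : ℝ) : ℂ) * Complex.I) = z ^ (n : ℕ) := by
    intro n; rw [hcast]; exact klct_legPhase_eq_pow (N := 2 * M) (n : ℕ) (j : ℕ)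
  simp_rw [hphase]
  have hgap := klct_rootOfUnity_gap (N := 2 * M) hN j.isLt
  have hsbp := klct_norm_mul_norm_sum_le_firstDiff (fun n : MatsubaraIdx M => (((gnScaleCutoff 4 klE0 1 |matsubaraFreq β M n| : ℝ) : ℂ))) z hzN
  have hTV := klct_firstDiffSum_uvCut_le hβ hM
  have h0 : 0 ≤ ‖∑ n : MatsubaraIdx M, (((gnScaleCutoff 4 klE0 1 |matsubaraFreq β M n| : ℝ) : ℂ)) * z ^ (n : ℕ)‖ := norm_nonneg _
  calc _ ≤ ‖∑ n : MatsubaraIdx M, (((gnScaleCutoff 4 klE0 1 |matsubaraFreq β M n| : ℝ) : ℂ)) * z ^ (n : ℕ)‖ * ‖z - 1‖ :=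
        mul_le_mul_of_nonneg_left hgap h0
    _ ≤ _ := by rw [mul_comm]; exact hsbp.trans hTV

/-! ## §3 The harmonic middle region and the three-region lemma -/

/-- **Harmonic middle sum**: `Σ_{v < n, J₁ < v ≤ J₂} v⁻¹ ≤ 1 + log(J₂/J₁)` for `1 ≤ J₁ ≤ J₂`. -/
theorem klct_sum_inv_middle_le {J₁ J₂ : ℕ} (hJ₁ : 1 ≤ J₁) (hJ : J₁ ≤ J₂) (n : ℕ) :
    ∑ v ∈ range n, (if J₁ < v ∧ v ≤ J₂ then ((v : ℝ))⁻¹ else 0) ≤ 1 + Real.log ((J₂ : ℝ) / J₁) := by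
  classical
  have hJ₁r : (0 : ℝ) < J₁ := by exact_mod_cast hJ₁
  have hJ₂r : (0 : ℝ) < J₂ := by exact_mod_cast (lt_of_lt_of_le hJ₁ hJ)
  -- restrict to the interval `Ioc J₁ J₂`
  have hle : ∑ v ∈ range n, (if J₁ < v ∧ v ≤ J₂ then ((v : ℝ))⁻¹ else 0) ≤ ∑ v ∈ Finset.Ioc J₁ J₂, ((v : ℝ))⁻¹ := by
    rw [← Finset.sum_filter]
    refine Finset.sum_le_sum_of_subset_of_nonneg ?_ (fun v _ _ => by positivity)
    intro v hv
    simp only [Finset.mem_filter, Finset.mem_range, Finset.mem_Ioc] at hv ⊢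
    exact ⟨hv.2.1, hv.2.2⟩
  refine hle.trans ?_
  -- `Σ_{Ioc J₁ J₂} v⁻¹ = harmonic J₂ − harmonic J₁`
  have hharm : ∀ m : ℕ, ((harmonic m : ℚ) : ℝ) = ∑ v ∈ Finset.Ioc 0 m, ((v : ℝ))⁻¹ := by
    intro m
    simp only [harmonic_eq_sum_Icc, Rat.cast_sum, Rat.cast_inv, Rat.cast_natCast]
    rfl
  have hsplit : ∑ v ∈ Finset.Ioc J₁ J₂, ((v : ℝ))⁻¹ = ((harmonic J₂ : ℚ) : ℝ) - ((harmonic J₁ : ℚ) : ℝ) := by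
    rw [hharm, hharm, ← Finset.sum_Ioc_consecutive _ (Nat.zero_le J₁) hJ]
    ring
  rw [hsplit]
  have h2 := harmonic_le_one_add_log J₂
  have h1 := log_add_one_le_harmonic J₁
  have h1' : Real.log J₁ ≤ Real.log ((J₁ + 1 : ℕ) : ℝ) := Real.log_le_log hJ₁r (by push_cast; linarith)
  rw [Real.log_div hJ₂r.ne' hJ₁r.ne']
  linarith

omit [NeZero M] in
/-- **THE THREE-REGION LEMMA.**  `h ≤ S` on `ℤ_N`, `h·d ≤ K₁` and `h·d² ≤ K₂` for `d = min(j,N−j) ≥ 1` (`0 ≤ S, K₁, K₂`); then for integers `1 ≤ J₁ ≤ J₂`: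
`Σ_j h(j) ≤ S(2J₁+1) + 2K₁(1 + log(J₂/J₁)) + 2K₂/J₂`. -/
theorem klct_sum_le_of_three_regions {N : ℕ} (h : Fin N → ℝ) {S K₁ K₂ : ℝ} (hS : 0 ≤ S) (hK₁ : 0 ≤ K₁) (hK₂ : 0 ≤ K₂) (hle : ∀ j, h j ≤ S)
    (hdec1 : ∀ j : Fin N, (j : ℕ) ≠ 0 → h j * (min (j : ℝ) ((N : ℝ) - j)) ≤ K₁)
    (hdec2 : ∀ j : Fin N, (j : ℕ) ≠ 0 → h j * (min (j : ℝ) ((N : ℝ) - j)) ^ 2 ≤ K₂) {J₁ J₂ : ℕ} (hJ₁ : 1 ≤ J₁) (hJ : J₁ ≤ J₂) :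
    ∑ j : Fin N, h j ≤ S * (2 * J₁ + 1) + 2 * K₁ * (1 + Real.log ((J₂ : ℝ) / J₁)) + 2 * K₂ / J₂ := by
  classical
  set h' : ℕ → ℝ := fun v => if hv : v < N then h ⟨v, hv⟩ else 0 with hh'
  have hsum : ∑ j : Fin N, h j = ∑ v ∈ range N, h' v := by
    rw [← Fin.sum_univ_eq_sum_range]
    exact Finset.sum_congr rfl (fun j _ => by simp [hh', j.isLt])
  rw [hsum]
  set b : ℕ → ℝ := fun v => (if v ≤ J₁ then S else 0) + (if N ≤ v + J₁ then S else 0) +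
      K₁ * (if J₁ < v ∧ v ≤ J₂ then ((v : ℝ))⁻¹ else 0) + K₁ * (if J₁ < N - v ∧ N - v ≤ J₂ then (((N - v : ℕ) : ℝ))⁻¹ else 0) +
      K₂ * (if J₂ < v then ((v : ℝ) ^ 2)⁻¹ else 0) + K₂ * (if J₂ < N - v then (((N - v : ℕ) : ℝ) ^ 2)⁻¹ else 0) with hb
  have hpt : ∀ v ∈ range N, h' v ≤ b v := by
    intro v hv
    have hvN : v < N := Finset.mem_range.mp hv
    have hv' : h' v = h ⟨v, hvN⟩ := by simp [hh', hvN]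
    rw [hv']
    have t1 : 0 ≤ (if v ≤ J₁ then S else 0) := by split_ifs <;> linarith
    have t2 : 0 ≤ (if N ≤ v + J₁ then S else 0) := by split_ifs <;> linarith
    have t3 : 0 ≤ K₁ * (if J₁ < v ∧ v ≤ J₂ then ((v : ℝ))⁻¹ else 0) := by apply mul_nonneg hK₁; split_ifs <;> positivity
    have t4 : 0 ≤ K₁ * (if J₁ < N - v ∧ N - v ≤ J₂ then (((N - v : ℕ) : ℝ))⁻¹ else 0) := by apply mul_nonneg hK₁; split_ifs <;> positivity
    have t5 : 0 ≤ K₂ * (if J₂ < v then ((v : ℝ) ^ 2)⁻¹ else 0) := by apply mul_nonneg hK₂; split_ifs <;> positivity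
    have t6 : 0 ≤ K₂ * (if J₂ < N - v then (((N - v : ℕ) : ℝ) ^ 2)⁻¹ else 0) := by apply mul_nonneg hK₂; split_ifs <;> positivity
    by_cases hvJ : v ≤ J₁
    · have := hle ⟨v, hvN⟩; simp only [hb, if_pos hvJ]; linarith
    by_cases hvJ' : N ≤ v + J₁
    · have := hle ⟨v, hvN⟩; simp only [hb, if_pos hvJ']; linarith
    push Not at hvJ hvJ'
    have hv0 : v ≠ 0 := by omega
    have hd1 := hdec1 ⟨v, hvN⟩ (by simpa using hv0)
    have hd2 := hdec2 ⟨v, hvN⟩ (by simpa using hv0)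
    have hNv : ((N - v : ℕ) : ℝ) = (N : ℝ) - v := by rw [Nat.cast_sub hvN.le]
    by_cases hside : 2 * v ≤ N
    · have hmin : min (v : ℝ) ((N : ℝ) - v) = v := by
        apply min_eq_left; have : ((2 * v : ℕ) : ℝ) ≤ N := by exact_mod_cast hside
        push_cast at this; linarith
      rw [hmin] at hd1 hd2
      have hvpos : (0 : ℝ) < (v : ℝ) := by exact_mod_cast Nat.pos_of_ne_zero hv0
      by_cases hvm : v ≤ J₂
      · have hq : h ⟨v, hvN⟩ ≤ K₁ * ((v : ℝ))⁻¹ := by rw [← div_eq_mul_inv, le_div_iff₀ hvpos]; exact hd1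
        have hc : J₁ < v ∧ v ≤ J₂ := ⟨hvJ, hvm⟩
        simp only [hb, if_pos hc]; linarith
      · push Not at hvm
        have hq : h ⟨v, hvN⟩ ≤ K₂ * ((v : ℝ) ^ 2)⁻¹ := by rw [← div_eq_mul_inv, le_div_iff₀ (by positivity)]; exact hd2
        simp only [hb, if_pos hvm]; linarith
    · have hmin : min (v : ℝ) ((N : ℝ) - v) = (N : ℝ) - v := by
        apply min_eq_right; push Not at hside
        have : (N : ℝ) < ((2 * v : ℕ) : ℝ) := by exact_mod_cast hside
        push_cast at this; linarith
      rw [hmin] at hd1 hd2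
      have hvpos : (0 : ℝ) < (N : ℝ) - v := by
        have : ((v : ℕ) : ℝ) < N := by exact_mod_cast hvN
        linarith
      by_cases hvm : N - v ≤ J₂
      · have hq : h ⟨v, hvN⟩ ≤ K₁ * (((N - v : ℕ) : ℝ))⁻¹ := by rw [hNv, ← div_eq_mul_inv, le_div_iff₀ hvpos]; exact hd1
        have hc : J₁ < N - v ∧ N - v ≤ J₂ := ⟨by omega, hvm⟩
        simp only [hb, if_pos hc]; linarith
      · push Not at hvm
        have hq : h ⟨v, hvN⟩ ≤ K₂ * (((N - v : ℕ) : ℝ) ^ 2)⁻¹ := by rw [hNv, ← div_eq_mul_inv, le_div_iff₀ (by positivity)]; exact hd2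
        simp only [hb, if_pos hvm]; linarith
  refine (Finset.sum_le_sum hpt).trans ?_
  simp only [hb, Finset.sum_add_distrib, ← Finset.mul_sum]
  have hJ₁r : (0 : ℝ) < J₁ := by exact_mod_cast hJ₁
  have hJ₂1 : 1 ≤ J₂ := hJ₁.trans hJ
  have hJ₂r : (0 : ℝ) < J₂ := by exact_mod_cast hJ₂1
  -- near parts
  have s1 : ∑ v ∈ range N, (if v ≤ J₁ then S else 0) ≤ S * (J₁ + 1) := by
    rw [Finset.sum_ite, Finset.sum_const_zero, add_zero, Finset.sum_const, nsmul_eq_mul, mul_comm]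
    gcongr
    have hsub : (range N).filter (fun v => v ≤ J₁) ⊆ range (J₁ + 1) := by
      intro v hv; simp only [Finset.mem_filter, Finset.mem_range] at hv ⊢; omega
    have := Finset.card_le_card hsub
    rw [Finset.card_range] at this
    exact_mod_cast this
  have s2 : ∑ v ∈ range N, (if N ≤ v + J₁ then S else 0) ≤ S * J₁ := by
    rw [Finset.sum_ite, Finset.sum_const_zero, add_zero, Finset.sum_const, nsmul_eq_mul, mul_comm]
    gcongr
    have hsub : (range N).filter (fun v => N ≤ v + J₁) ⊆ Finset.Ico (N - J₁) N := by
      intro v hv; simp only [Finset.mem_filter, Finset.mem_range, Finset.mem_Ico] at hv ⊢; omega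
    have hcard : ((range N).filter (fun v => N ≤ v + J₁)).card ≤ J₁ := by
      have := Finset.card_le_card hsub
      rw [Nat.card_Ico] at this
      omega
    exact_mod_cast hcard
  -- middle parts
  have s3 : K₁ * ∑ v ∈ range N, (if J₁ < v ∧ v ≤ J₂ then ((v : ℝ))⁻¹ else 0) ≤ K₁ * (1 + Real.log ((J₂ : ℝ) / J₁)) :=
    mul_le_mul_of_nonneg_left (klct_sum_inv_middle_le hJ₁ hJ N) hK₁
  have s4 : K₁ * ∑ v ∈ range N, (if J₁ < N - v ∧ N - v ≤ J₂ then (((N - v : ℕ) : ℝ))⁻¹ else 0) ≤ K₁ * (1 + Real.log ((J₂ : ℝ) / J₁)) := by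
    refine mul_le_mul_of_nonneg_left ?_ hK₁
    have hrefl : ∑ v ∈ range N, (if J₁ < N - v ∧ N - v ≤ J₂ then (((N - v : ℕ) : ℝ))⁻¹ else 0) =
        ∑ v ∈ range N, (if J₁ < v + 1 ∧ v + 1 ≤ J₂ then (((v + 1 : ℕ) : ℝ))⁻¹ else 0) := by
      rw [← Finset.sum_range_reflect (fun v => (if J₁ < v + 1 ∧ v + 1 ≤ J₂ then (((v + 1 : ℕ) : ℝ))⁻¹ else 0)) N]
      refine Finset.sum_congr rfl (fun v hv => ?_)
      have hvN := Finset.mem_range.mp hv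
      have : N - 1 - v + 1 = N - v := by omega
      simp only [this]
    rw [hrefl]
    have hshift : ∑ v ∈ range N, (if J₁ < v + 1 ∧ v + 1 ≤ J₂ then (((v + 1 : ℕ) : ℝ))⁻¹ else 0) ≤
        ∑ v ∈ range (N + 1), (if J₁ < v ∧ v ≤ J₂ then ((v : ℝ))⁻¹ else 0) := by
      rw [Finset.sum_range_succ']
      have : ¬ (J₁ < 0 ∧ 0 ≤ J₂) := by omega
      simp only [this, if_false, add_zero]
      push_cast
      exact le_rfl
    exact hshift.trans (klct_sum_inv_middle_le hJ₁ hJ (N + 1))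
  -- far parts
  have s5 : K₂ * ∑ v ∈ range N, (if J₂ < v then ((v : ℝ) ^ 2)⁻¹ else 0) ≤ K₂ * (1 / J₂) :=
    mul_le_mul_of_nonneg_left (klct_sum_inv_sq_tail_le hJ₂1 N) hK₂
  have s6 : K₂ * ∑ v ∈ range N, (if J₂ < N - v then (((N - v : ℕ) : ℝ) ^ 2)⁻¹ else 0) ≤ K₂ * (1 / J₂) := by
    refine mul_le_mul_of_nonneg_left ?_ hK₂
    have hrefl : ∑ v ∈ range N, (if J₂ < N - v then (((N - v : ℕ) : ℝ) ^ 2)⁻¹ else 0) =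
        ∑ v ∈ range N, (if J₂ < v + 1 then (((v + 1 : ℕ) : ℝ) ^ 2)⁻¹ else 0) := by
      rw [← Finset.sum_range_reflect (fun v => (if J₂ < v + 1 then (((v + 1 : ℕ) : ℝ) ^ 2)⁻¹ else 0)) N]
      refine Finset.sum_congr rfl (fun v hv => ?_)
      have hvN := Finset.mem_range.mp hv
      have : N - 1 - v + 1 = N - v := by omega
      simp only [this]
    rw [hrefl]
    have hshift : ∑ v ∈ range N, (if J₂ < v + 1 then (((v + 1 : ℕ) : ℝ) ^ 2)⁻¹ else 0) ≤
        ∑ v ∈ range (N + 1), (if J₂ < v then ((v : ℝ) ^ 2)⁻¹ else 0) := by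
      rw [Finset.sum_range_succ']
      simp only [show ¬ J₂ < 0 from Nat.not_lt_zero J₂, if_false, add_zero]
      push_cast
      exact le_rfl
    exact hshift.trans (klct_sum_inv_sq_tail_le hJ₂1 (N + 1))
  have htot : S * (J₁ + 1) + S * J₁ + K₁ * (1 + Real.log ((J₂ : ℝ) / J₁)) + K₁ * (1 + Real.log ((J₂ : ℝ) / J₁)) + K₂ * (1 / J₂) + K₂ * (1 / J₂) =
      S * (2 * J₁ + 1) + 2 * K₁ * (1 + Real.log ((J₂ : ℝ) / J₁)) + 2 * K₂ / J₂ := by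
    field_simp; ring
  linarith [s1, s2, s3, s4, s5, s6]

end Summit.HubbardSuperconductivity.HubbardSuperconductivity.Theorems.KLRegimeSplit

end
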